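/-
Copyright (c) 2026 the pub-hodgecm-mathlib formalisation cell (harness21).  Prover seat hodgecm-mathlib-F0P2-p11 (g2) (L1; LEAD F0P6-plan (g14) «(o1) KIND 1»), Track B «K2-LIT» ∕
hLiu418 #184♮, ROAD Φ, G5-b: THE TRANSPORTED INDEX of the Levi conjugation `u ↦ Λĝ⁻¹ u Λĝ` for a RATIONAL `ĝ` — the `hψ` supplier of ★ p862629 ∕ ★ p862785.  THEOREMS ONLY.
-/
import Summits.HodgeConjecture.HodgeConjecture.Theorems.K2LiuSiegelLeviConjUnipDeltaChar      -- ★ `unipDeltaChar_conj_eq`, `exists_rat_levi_blocks`, `conj_index_mem_skewMatrices`, `det_conj_index_ne_zero_iff`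
import Summits.HodgeConjecture.HodgeConjecture.Theorems.K2LiuSiegelRationalLeviDecomposition  -- ★ `isSiegelDelta_levi_apply`, `levi_map_mem_ratH`
import HarnessLib

/-!
# Crux `HLiu418`, KIND 1: the transported index `S' = D₀ S A₀⁻¹` of `ψ_S(Λĝ⁻¹ · Λĝ)` for rational `ĝ` — existence with skewness and rank preserved

Cell `hodgecm-mathlib`, crux item hLiu418 = `stmt-HodgeConjecture-24832` (helper lane, count-neutral); squad K2 ∕ K2Liu, LEAD F0P6-plan (g14); prover F0P2-p11 (g2).
THEOREMS ONLY (no `def`, no `instance`, no notation, no named-fact hypothesis, no `sorry`).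

★ p862629 `cornerLine_integral_eq_whittakerDelta_line_levi` and ★ p862785 `exists_middle_cell_rankOne_eq_whittakerDelta_line` take BY VALUE a re-indexing
`hψ : ∀ v ∈ N_Δ(𝔸), ψ_S(m⁻¹ v m) = ψ_{S'}(v)` at `m = Λ(ĝ ⊗ 1)`.  For the Levi chart `Λ ∕ hΛ` of the rank-one files and a RATIONAL `ĝ ∈ GL_n(L)` this file SUPPLIES it:
**`exists_levi_conj_index`** — `∃ S', (S skew → S' skew) ∧ (det S' ≠ 0 ↔ det S ≠ 0) ∧ hψ` (★ `exists_rat_levi_blocks` at `p = Λ(ĝ ⊗ 1)` — Siegel ★ `isSiegelDelta_levi_apply`, rational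
★ `levi_map_mem_ratH` —, then ★ `unipDeltaChar_conj_eq`, ★ `conj_index_mem_skewMatrices`, ★ `det_conj_index_ne_zero_iff`; `S' = D₀ S A₀⁻¹`).
HONEST LABEL.  Count-neutral helper; `HC_CM` is proved only modulo the 7 printed citations (2 remaining named inputs: hLiu418 = `stmt-HodgeConjecture-24832`,
h413 = `stmt-HodgeConjecture-24833`) until rung 0 closes.

## References
* [HarrisKudlaSweet1996] M. Harris, S. Kudla, W. Sweet, J. AMS 9 (1996), §1 (1.11).
* [Shimura1997] G. Shimura, CBMS 93 (1997), §18.1 (18.4).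
* [MoeglinWaldspurger1995] C. Mœglin, J.-L. Waldspurger, CUP (1995), I.2.1, I.2.6.
-/

set_option autoImplicit false
set_option linter.dupNamespace false -- the mandated namespace repeats `HodgeConjecture.HodgeConjecture`

noncomputable section

open scoped Matrix
open NumberField IsDedekindDomain
open Literature.NumberTheory.Automorphic Literature.NumberTheory.Automorphic.UnitaryGroup Literature.NumberTheory.GaloisRepresentations
open Literature.NumberTheory.GelbartRogawski1991 Literature.NumberTheory.GelbartRogawski1991.GRConstruction
open Literature.NumberTheory.GelbartRogawski1991.AdaptedBlocks
open Literature.NumberTheory.K2Lit.SiegelDoubled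
open UnitaryDualPair

namespace Summit.HodgeConjecture.HodgeConjecture.Cruxes.HLiu418.K2LiuRankOneLeviConjIndex

open K2LiuSiegelUnipotentFourierDefs K2LiuSiegelLeviConjUnipDeltaChar K2LiuSiegelRationalLeviDecomposition

variable (L : Type) [Field L] [NumberField L] [IsCMField L]
variable {N M n : ℕ} (e : Fin N × Fin M ≃ Fin n)
  (dV : Fin N → L) (hdV : ∀ i, IsCMField.complexConj L (dV i) = dV i)
  (dW : Fin M → L) (hdW : ∀ i, IsCMField.complexConj L (dW i) = dW i)
  (Λ : GL (Fin n) (AdeleRing (𝓞 L) L) →* HA L e dV hdV dW hdW)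
  (hΛ : ∀ g : GL (Fin n) (AdeleRing (𝓞 L) L), blk L e dV hdV dW hdW (Λ g) =
    cayR (AdeleRing (𝓞 L) L) (Fin n) * Matrix.fromBlocks (g : Matrix (Fin n) (Fin n) (AdeleRing (𝓞 L) L)) 0 0
      (((gramR L e dV hdV dW hdW).map ((algebraMap L (AdeleRing (𝓞 L) L)).comp (algebraMap (Fp L) L)))⁻¹ *
        (((g⁻¹ : GL (Fin n) (AdeleRing (𝓞 L) L)) : Matrix (Fin n) (Fin n) (AdeleRing (𝓞 L) L)).map
          (conjAdele (Fp L) L (IsCMField.complexConj L)))ᵀ *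
        (gramR L e dV hdV dW hdW).map ((algebraMap L (AdeleRing (𝓞 L) L)).comp (algebraMap (Fp L) L))) *
      cayRinv (AdeleRing (𝓞 L) L) (Fin n))

include hΛ in
/-- **THE TRANSPORTED INDEX**: for the Levi chart `Λ ∕ hΛ`, a rational `ĝ ∈ GL_n(L)` and any index `S ∈ M_n(L)` there is `S' ∈ M_n(L)` with
`ψ_S(Λ(ĝ⊗1)⁻¹ · v · Λ(ĝ⊗1)) = ψ_{S'}(v)` for all `v ∈ N_Δ(𝔸)`, `S' = D₀ S A₀⁻¹` for the rational Levi blocks of `Λ(ĝ⊗1)`; `S'` is `T_L`-skew if `S` is, and `det S' ≠ 0 ↔ det S ≠ 0`.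
[cite: HarrisKudlaSweet1996, §1 (1.11)] [cite: Shimura1997, §18.1 (18.4)] [cite: MoeglinWaldspurger1995, I.2.6] -/
theorem exists_levi_conj_index (hdV0 : ∀ i, dV i ≠ 0) (hdW0 : ∀ i, dW i ≠ 0) (g : GL (Fin n) L) (S : Matrix (Fin n) (Fin n) L) :
    ∃ S' : Matrix (Fin n) (Fin n) L,
      (S ∈ skewMatrices ((IsCMField.complexConj L : L ≃ₐ[Fp L] L) : L →+* L) ((gramR L e dV hdV dW hdW).map (algebraMap (Fp L) L)) →
        S' ∈ skewMatrices ((IsCMField.complexConj L : L ≃ₐ[Fp L] L) : L →+* L) ((gramR L e dV hdV dW hdW).map (algebraMap (Fp L) L))) ∧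
      (S'.det ≠ 0 ↔ S.det ≠ 0) ∧
      ∀ v : HA L e dV hdV dW hdW, v ∈ unipDelta L e dV hdV dW hdW →
        unipDeltaChar L e dV hdV dW hdW S
            ((Λ (Matrix.GeneralLinearGroup.map (algebraMap L (AdeleRing (𝓞 L) L)) g))⁻¹ * v *
              Λ (Matrix.GeneralLinearGroup.map (algebraMap L (AdeleRing (𝓞 L) L)) g)) =
          unipDeltaChar L e dV hdV dW hdW S' v := by
  have hp : IsSiegelDelta L e dV hdV dW hdW (Λ (Matrix.GeneralLinearGroup.map (algebraMap L (AdeleRing (𝓞 L) L)) g)) :=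
    isSiegelDelta_levi_apply L e dV hdV dW hdW Λ hΛ _
  have hpr := levi_map_mem_ratH L e dV hdV dW hdW Λ hΛ hdV0 hdW0 g
  obtain ⟨A₀, D₀, hA₀, ha, hd, hrel⟩ := exists_rat_levi_blocks L e dV hdV dW hdW hdV0 hdW0 hp hpr
  exact ⟨D₀ * S * A₀⁻¹, fun hS => conj_index_mem_skewMatrices L e dV hdV dW hdW hdV0 hdW0 hA₀ hrel hS,
    det_conj_index_ne_zero_iff L e dV hdV dW hdW hdV0 hdW0 hA₀ hrel S, fun v hv => unipDeltaChar_conj_eq L e dV hdV dW hdW hp hA₀ ha hd S hv⟩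

end Summit.HodgeConjecture.HodgeConjecture.Cruxes.HLiu418.K2LiuRankOneLeviConjIndex

end
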